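import Literature.NumberTheory.ConnesConsani2021.ProlateProjectionsProofs
import Literature.NumberTheory.ConnesConsani2021.ArchDensityOfMajorant
import Literature.NumberTheory.LFunctions.ProlateEigenvalueLegendreBounds
import Literature.NumberTheory.LFunctions.ConnesProlateGuessSupNorm
import HarnessLib

/-!
# Polynomial decay of the prolate eigenvalues `λ(n)` in the Sturm index — unconditionally

RH-FREE corpus literature (label, line 1): elementary Sturm–Liouville bookkeeping for Slepian's
prolate functions; nothing in this file mentions `ζ`, the critical strip or RH, and nothing here bears
on the truth of RH.  bears_on (cell rh-crit, corpus C1): the decay input of apex (B) — route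
«ConnesConsaniSemilocal» items K0 `DensityRegular` (stmt 19307) and K2 `DensitySlope` (stmt 19308).

## What is proved (0 definitions, 0 named facts)

Connes–Consani 2021 §4 p. 16 use, for the eigenvalues `λ(n)` of the finite Fourier transform on the
even prolate functions `ψ_n = PS_{2n,0}(2π, ·)`, the super-exponential bound (rapid-decay) quoted from
[Rokhlin–Xiao 2007, Thm 14] — whose printed derivation rests on an unproved asymptotic expansion (cell
erratum E17) —, and the cell's substitute of record was Osipov's explicit bound [Osipov 2013, Thm 33]
(`Osipov2013_thm_33`, a named fact).  Everything the archimedean density chain of §5/App. F actually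
CONSUMES (`ArchDensityOfMajorant.lean`: `exists_contDiff_isArchDensity_of_summable`,
`CC2021_lemma_5_4_of_summable`, `CC2021_prop_5_3_of_summable`, `CC2021_rem_5_6_of_summable`) is the
single qualitative input `Σ_n |λ(n)|·n² < ∞`.  This file PROVES that input with no literature fact at
all, by the classical smooth-kernel argument:

* `IsProlateFunction.eigen_mul_integral_mul_eq` — **Green symmetry** of the prolate operator
  `L = −∂_x(λ² − x²)∂_x + (2πλx)²` against a `C²` test function `g`:
  `χ · ∫_{−λ}^{λ} f g = ∫_{−λ}^{λ} f · Lg` for `f = h_{n,λ}` with eigenvalue `χ` (the weight `λ² − x²`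
  kills the boundary terms; the Wronskian bookkeeping of `IsProlateFunction.integral_mul_eq_zero_of_ne`);
* applied twice to the cosine wave `g_ω(x) = cos(2πxω)` at `λ = 1`, with (cosalphan)
  `∫ ψ_n(x)cos(2πxω)dx = λ(n)ψ_n(ω)` (tree theorem `IsProlateFunction.integral_mul_cos_eq_mul`):
  `χ_{2n}² · λ(n) ψ_n(ω) = ∫_{−1}^{1} ψ_n(x) · (L_x² cos(2πxω)) dx`, and the right-hand side is bounded
  uniformly in `n` and `ω ∈ [−1,1]` (`|ψ| ≤ (1 + ψ²)/2`, `∫ψ² = 1`, `L_x²cos(2πxω)` continuous on the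
  square); some `ω₀` has `|ψ_n(ω₀)| ≥ 1/2` since `∫ψ_n² = 1`;
* with [Wang 2010, Lemma 2.2] `χ_{2n} > 2n(2n+1)` (tree: `IsProlateFunction.lt_eigen`):
  `exists_bound_abs_prolateEigen_mul_sq_sq` — `|λ(n)|·(2n(2n+1))² ≤ C` —, hence
  **`summable_abs_prolateEigen_mul_sq : Summable (fun n ↦ |prolateEigen n| * n²)`**;
* corollaries by `ArchDensityOfMajorant`: **`CC2021_lemma_5_4_holds`, `CC2021_prop_5_3_holds`,
  `CC2021_rem_5_6_holds`** (the three named facts of `TraceRemainderEpsilon.lean`, DISCHARGED) and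
  `exists_contDiff_isArchDensity_summable_free` (the K0 input, hypothesis-free).

Sources: A. Connes, C. Consani, *Weil positivity and trace formula, the archimedean place*, Selecta
Math. (N.S.) 27 (2021) 77 = arXiv:2006.13771 [bib `ConnesConsani2021`], §4 p. 16 eqs. (prolateeq),
(cosalphan), (rapid-decay); Lemma 5.4 / Prop. 5.3 / Rem. 5.6 §5 pp. 32–34; App. F.  D. Slepian,
H. O. Pollak, Bell Syst. Tech. J. 40 (1961) §III (the commuting differential operator).  L.-L. Wang,
Math. Comp. 79 (2010) Lemma 2.2.  The polynomial-decay argument is folklore (integration by parts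
against a smooth kernel commuting with a Sturm–Liouville operator).

WHAT THIS FILE IS NOT: a super-exponential bound (the printed (rapid-decay) display stays as typed in
`ProlateProjections.lean`); anything about `ζ` or RH.
-/

noncomputable section

open Real Set MeasureTheory Filter Topology

namespace Literature.NumberTheory.ConnesConsani2021

open Literature.NumberTheory.LFunctions

/-! ## Green symmetry of the prolate operator against a `C²` test function -/

/-- RH-FREE. **Green symmetry (Lagrange identity) for the prolate operator.**  For a tree prolate
function `f = h_{n,λ}` with eigenvalue `χ` and any `g` with two (everywhere) derivatives `g₁, g₂`,
`g₂` continuous: `χ ∫_{−λ}^{λ} f g = ∫_{−λ}^{λ} f · Lg`, `Lg = −((λ²−x²)g₂ − 2x g₁) + (2πλx)² g`.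
Proof: the Wronskian `W = (λ²−x²)(f′g − g₁f)` has `W′ = f·(Lg − χg)` on `(−λ, λ)` and vanishes at
`±λ`. [cite: CoddingtonLevinson1955, Ch. 8 §1 (Green's formula); SlepianPollak1961, §III] -/
theorem _root_.Literature.NumberTheory.LFunctions.IsProlateFunction.eigen_mul_integral_mul_eq
    {lam : ℝ} {n : ℕ} {f : ℝ → ℝ} (hf : IsProlateFunction lam n f) {χ : ℝ}
    (hχ : ∀ x ∈ Ioo (-lam) lam,
      -(deriv (fun y ↦ (lam ^ 2 - y ^ 2) * deriv f y) x) + (2 * π * lam * x) ^ 2 * f x = χ * f x)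
    {g g₁ g₂ : ℝ → ℝ} (hg : ∀ x, HasDerivAt g (g₁ x) x) (hg₁ : ∀ x, HasDerivAt g₁ (g₂ x) x)
    (hg₂ : Continuous g₂) :
    χ * ∫ x in (-lam)..lam, f x * g x =
      ∫ x in (-lam)..lam,
        f x * (-((lam ^ 2 - x ^ 2) * g₂ x - 2 * x * g₁ x) + (2 * π * lam * x) ^ 2 * g x) := by
  have hlam := hf.lam_pos
  have hle : -lam ≤ lam := by linarith
  have hgc : Continuous g := continuous_iff_continuousAt.2 fun x ↦ (hg x).continuousAt
  have hg₁c : Continuous g₁ := continuous_iff_continuousAt.2 fun x ↦ (hg₁ x).continuousAt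
  have hfc : ContinuousOn f (Icc (-lam) lam) := hf.contDiffOn.continuousOn
  set f₁ := derivWithin f (Icc (-lam) lam) with hf₁
  have hf₁c : ContinuousOn f₁ (Icc (-lam) lam) := hf.continuousOn_derivWithin
  -- the Wronskian
  set W : ℝ → ℝ := fun x ↦ (lam ^ 2 - x ^ 2) * f₁ x * g x - (lam ^ 2 - x ^ 2) * g₁ x * f x with hW
  have hp : Continuous fun x : ℝ ↦ lam ^ 2 - x ^ 2 := by fun_prop
  have hWcont : ContinuousOn W (Icc (-lam) lam) :=
    ((hp.continuousOn.mul hf₁c).mul hgc.continuousOn).sub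
      ((hp.continuousOn.mul hg₁c.continuousOn).mul hfc)
  -- its derivative on the open interval
  set w : ℝ → ℝ := fun x ↦
    f x * (-((lam ^ 2 - x ^ 2) * g₂ x - 2 * x * g₁ x) + (2 * π * lam * x) ^ 2 * g x) - χ * (f x * g x)
    with hw
  have hWderiv : ∀ x ∈ Ioo (-lam) lam, HasDerivAt W (w x) x := by
    intro x hx
    have hF := hf.hasDerivAt_flux hχ hx
    have hf' := hf.hasDerivAt_derivWithin hx
    have hpx : HasDerivAt (fun y : ℝ ↦ lam ^ 2 - y ^ 2) (-(2 * x)) x := by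
      simpa using (hasDerivAt_pow 2 x).const_sub (lam ^ 2)
    have h1 : HasDerivAt (fun y ↦ (lam ^ 2 - y ^ 2) * derivWithin f (Icc (-lam) lam) y * g y)
        (((2 * π * lam * x) ^ 2 - χ) * f x * g x
          + (lam ^ 2 - x ^ 2) * derivWithin f (Icc (-lam) lam) x * g₁ x) x := hF.mul (hg x)
    have hpg : HasDerivAt (fun y ↦ (lam ^ 2 - y ^ 2) * g₁ y)
        (-(2 * x) * g₁ x + (lam ^ 2 - x ^ 2) * g₂ x) x := hpx.mul (hg₁ x)
    have h2 : HasDerivAt (fun y ↦ (lam ^ 2 - y ^ 2) * g₁ y * f y)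
        ((-(2 * x) * g₁ x + (lam ^ 2 - x ^ 2) * g₂ x) * f x
          + (lam ^ 2 - x ^ 2) * g₁ x * derivWithin f (Icc (-lam) lam) x) x := hpg.mul hf'
    have h := h1.sub h2
    have hfun : W = fun y ↦ (lam ^ 2 - y ^ 2) * derivWithin f (Icc (-lam) lam) y * g y -
        (lam ^ 2 - y ^ 2) * g₁ y * f y := by
      funext y
      simp only [hW, hf₁]
    rw [hfun]
    refine h.congr_deriv ?_
    simp only [hw]
    ring
  have hWa : W (-lam) = 0 := by simp [hW]
  have hWb : W lam = 0 := by simp [hW]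
  -- integrability of the pieces
  have hLg : Continuous fun x ↦
      -((lam ^ 2 - x ^ 2) * g₂ x - 2 * x * g₁ x) + (2 * π * lam * x) ^ 2 * g x := by fun_prop
  have hi1 : IntervalIntegrable (fun x ↦ f x *
      (-((lam ^ 2 - x ^ 2) * g₂ x - 2 * x * g₁ x) + (2 * π * lam * x) ^ 2 * g x)) volume (-lam) lam :=
    (hfc.mul hLg.continuousOn).intervalIntegrable_of_Icc hle
  have hi2 : IntervalIntegrable (fun x ↦ f x * g x) volume (-lam) lam :=
    (hfc.mul hgc.continuousOn).intervalIntegrable_of_Icc hle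
  have hwi : IntervalIntegrable w volume (-lam) lam := hi1.sub (hi2.const_mul χ)
  have hFTC := intervalIntegral.integral_eq_sub_of_hasDerivAt_of_le hle hWcont hWderiv hwi
  rw [hWb, hWa, sub_zero] at hFTC
  have hsplit : ∫ x in (-lam)..lam, w x =
      (∫ x in (-lam)..lam, f x *
          (-((lam ^ 2 - x ^ 2) * g₂ x - 2 * x * g₁ x) + (2 * π * lam * x) ^ 2 * g x)) -
        χ * ∫ x in (-lam)..lam, f x * g x := by
    simp only [hw]
    rw [intervalIntegral.integral_sub hi1 (hi2.const_mul χ), intervalIntegral.integral_const_mul]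
  linarith [hFTC, hsplit]

/-! ## The cosine wave and its two prolate images (explicit calculus) -/

/-- Derivative of the phase `x ↦ 2πxω`. [folklore] -/
private theorem hasDerivAt_phase (ω x : ℝ) :
    HasDerivAt (fun x : ℝ ↦ 2 * π * x * ω) (2 * π * ω) x := by
  have h : HasDerivAt (fun x : ℝ ↦ 2 * π * x * ω) _ x :=
    ((hasDerivAt_id x).const_mul (2 * π)).mul_const ω
  exact h.congr_deriv (by simp)

/-- `d/dx cos(2πxω) = −2πω sin(2πxω)`. [folklore] -/
private theorem hasDerivAt_cosWave (ω x : ℝ) :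
    HasDerivAt (fun x : ℝ ↦ Real.cos (2 * π * x * ω))
      (-(2 * π * ω) * Real.sin (2 * π * x * ω)) x := by
  have h : HasDerivAt (fun x : ℝ ↦ Real.cos (2 * π * x * ω)) _ x :=
    (Real.hasDerivAt_cos _).comp x (hasDerivAt_phase ω x)
  exact h.congr_deriv (by ring)

/-- `d/dx sin(2πxω) = 2πω cos(2πxω)`. [folklore] -/
private theorem hasDerivAt_sinWave (ω x : ℝ) :
    HasDerivAt (fun x : ℝ ↦ Real.sin (2 * π * x * ω))
      ((2 * π * ω) * Real.cos (2 * π * x * ω)) x := by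
  have h : HasDerivAt (fun x : ℝ ↦ Real.sin (2 * π * x * ω)) _ x :=
    (Real.hasDerivAt_sin _).comp x (hasDerivAt_phase ω x)
  exact h.congr_deriv (by ring)

/-- `d/dx (−2πω sin(2πxω)) = −(2πω)² cos(2πxω)`. [folklore] -/
private theorem hasDerivAt_cosWave₁ (ω x : ℝ) :
    HasDerivAt (fun x : ℝ ↦ -(2 * π * ω) * Real.sin (2 * π * x * ω))
      (-(2 * π * ω) ^ 2 * Real.cos (2 * π * x * ω)) x := by
  have h : HasDerivAt (fun x : ℝ ↦ -(2 * π * ω) * Real.sin (2 * π * x * ω)) _ x :=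
    (hasDerivAt_sinWave ω x).const_mul (-(2 * π * ω))
  exact h.congr_deriv (by ring)

/-- **`h_ω = L_x cos(2πxω)`** written out:
`((2πω)²(1−x²) + (2πx)²) cos(2πxω) − 4πωx sin(2πxω)`. [folklore] -/
private theorem prolateOp_cosWave (ω x : ℝ) :
    -(((1 : ℝ) ^ 2 - x ^ 2) * (-(2 * π * ω) ^ 2 * Real.cos (2 * π * x * ω))
        - 2 * x * (-(2 * π * ω) * Real.sin (2 * π * x * ω)))
      + (2 * π * 1 * x) ^ 2 * Real.cos (2 * π * x * ω)
    = ((2 * π * ω) ^ 2 * (1 - x ^ 2) + (2 * π * x) ^ 2) * Real.cos (2 * π * x * ω)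
        - 4 * π * ω * x * Real.sin (2 * π * x * ω) := by
  ring

/-- Derivative of the polynomial coefficient `(2πω)²(1−x²) + (2πx)²`. [folklore] -/
private theorem hasDerivAt_coeffA (ω x : ℝ) :
    HasDerivAt (fun x : ℝ ↦ (2 * π * ω) ^ 2 * (1 - x ^ 2) + (2 * π * x) ^ 2)
      (-(2 * (2 * π * ω) ^ 2 * x) + 8 * π ^ 2 * x) x := by
  have h1 : HasDerivAt (fun x : ℝ ↦ (2 * π * ω) ^ 2 * (1 - x ^ 2)) _ x :=
    ((hasDerivAt_pow 2 x).const_sub (1 : ℝ)).const_mul ((2 * π * ω) ^ 2)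
  have h2 : HasDerivAt (fun x : ℝ ↦ (2 * π * x) ^ 2) _ x :=
    ((hasDerivAt_id x).const_mul (2 * π)).pow 2
  have h : HasDerivAt (fun x : ℝ ↦ (2 * π * ω) ^ 2 * (1 - x ^ 2) + (2 * π * x) ^ 2) _ x := h1.add h2
  exact h.congr_deriv (by simp; ring)

/-- Derivative of the polynomial coefficient `−2(2πω)²x + 8π²x`. [folklore] -/
private theorem hasDerivAt_coeffP (ω x : ℝ) :
    HasDerivAt (fun x : ℝ ↦ -(2 * (2 * π * ω) ^ 2 * x) + 8 * π ^ 2 * x)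
      (-(2 * (2 * π * ω) ^ 2) + 8 * π ^ 2) x := by
  have h : HasDerivAt (fun x : ℝ ↦ -(2 * (2 * π * ω) ^ 2 * x) + 8 * π ^ 2 * x) _ x :=
    ((hasDerivAt_id x).const_mul (2 * (2 * π * ω) ^ 2)).neg.add ((hasDerivAt_id x).const_mul (8 * π ^ 2))
  exact h.congr_deriv (by simp)

/-- Derivative of the linear coefficient `4πωx`. [folklore] -/
private theorem hasDerivAt_coeffB (ω x : ℝ) :
    HasDerivAt (fun x : ℝ ↦ 4 * π * ω * x) (4 * π * ω) x := by
  have h : HasDerivAt (fun x : ℝ ↦ 4 * π * ω * x) _ x := (hasDerivAt_id x).const_mul (4 * π * ω)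
  exact h.congr_deriv (by simp)

/-- First `x`-derivative of `h_ω`. [folklore] -/
private theorem hasDerivAt_hWave (ω x : ℝ) :
    HasDerivAt (fun x : ℝ ↦ ((2 * π * ω) ^ 2 * (1 - x ^ 2) + (2 * π * x) ^ 2) * Real.cos (2 * π * x * ω)
        - 4 * π * ω * x * Real.sin (2 * π * x * ω))
      ((-(2 * (2 * π * ω) ^ 2 * x) + 8 * π ^ 2 * x) * Real.cos (2 * π * x * ω)
        + ((2 * π * ω) ^ 2 * (1 - x ^ 2) + (2 * π * x) ^ 2) * (-(2 * π * ω) * Real.sin (2 * π * x * ω))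
        - (4 * π * ω * Real.sin (2 * π * x * ω)
            + 4 * π * ω * x * ((2 * π * ω) * Real.cos (2 * π * x * ω)))) x :=
  ((hasDerivAt_coeffA ω x).mul (hasDerivAt_cosWave ω x)).sub
    ((hasDerivAt_coeffB ω x).mul (hasDerivAt_sinWave ω x))

/-- Second `x`-derivative of `h_ω`. [folklore] -/
private theorem hasDerivAt_hWave₁ (ω x : ℝ) :
    HasDerivAt (fun x : ℝ ↦ (-(2 * (2 * π * ω) ^ 2 * x) + 8 * π ^ 2 * x) * Real.cos (2 * π * x * ω)
        + ((2 * π * ω) ^ 2 * (1 - x ^ 2) + (2 * π * x) ^ 2) * (-(2 * π * ω) * Real.sin (2 * π * x * ω))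
        - (4 * π * ω * Real.sin (2 * π * x * ω)
            + 4 * π * ω * x * ((2 * π * ω) * Real.cos (2 * π * x * ω))))
      ((-(2 * (2 * π * ω) ^ 2) + 8 * π ^ 2) * Real.cos (2 * π * x * ω)
        + (-(2 * (2 * π * ω) ^ 2 * x) + 8 * π ^ 2 * x) * (-(2 * π * ω) * Real.sin (2 * π * x * ω))
        + ((-(2 * (2 * π * ω) ^ 2 * x) + 8 * π ^ 2 * x) * (-(2 * π * ω) * Real.sin (2 * π * x * ω))
            + ((2 * π * ω) ^ 2 * (1 - x ^ 2) + (2 * π * x) ^ 2)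
                * (-(2 * π * ω) ^ 2 * Real.cos (2 * π * x * ω)))
        - (4 * π * ω * ((2 * π * ω) * Real.cos (2 * π * x * ω))
            + (4 * π * ω * ((2 * π * ω) * Real.cos (2 * π * x * ω))
                + 4 * π * ω * x * ((2 * π * ω) * (-(2 * π * ω) * Real.sin (2 * π * x * ω)))))) x :=
  (((hasDerivAt_coeffP ω x).mul (hasDerivAt_cosWave ω x)).add
      ((hasDerivAt_coeffA ω x).mul (hasDerivAt_cosWave₁ ω x))).sub
    (((hasDerivAt_sinWave ω x).const_mul (4 * π * ω)).add
      ((hasDerivAt_coeffB ω x).mul ((hasDerivAt_cosWave ω x).const_mul (2 * π * ω))))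

/-! ## The uniform bound on `L_x² cos(2πxω)` -/

/-- Continuity of `(x, ω) ↦ L_x h_ω(x)` in both variables (an explicit trigonometric polynomial) gives a
uniform bound on the square `[−1,1]²`. [folklore] -/
private theorem exists_bound_prolateOp_hWave :
    ∃ C : ℝ, ∀ ω ∈ Icc (-1 : ℝ) 1, ∀ x ∈ Icc (-1 : ℝ) 1,
      |-(((1 : ℝ) ^ 2 - x ^ 2) *
            ((-(2 * (2 * π * ω) ^ 2) + 8 * π ^ 2) * Real.cos (2 * π * x * ω)
              + (-(2 * (2 * π * ω) ^ 2 * x) + 8 * π ^ 2 * x) * (-(2 * π * ω) * Real.sin (2 * π * x * ω))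
              + ((-(2 * (2 * π * ω) ^ 2 * x) + 8 * π ^ 2 * x) * (-(2 * π * ω) * Real.sin (2 * π * x * ω))
                  + ((2 * π * ω) ^ 2 * (1 - x ^ 2) + (2 * π * x) ^ 2)
                      * (-(2 * π * ω) ^ 2 * Real.cos (2 * π * x * ω)))
              - (4 * π * ω * ((2 * π * ω) * Real.cos (2 * π * x * ω))
                  + (4 * π * ω * ((2 * π * ω) * Real.cos (2 * π * x * ω))
                      + 4 * π * ω * x * ((2 * π * ω) * (-(2 * π * ω) * Real.sin (2 * π * x * ω))))))
          - 2 * x *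
            ((-(2 * (2 * π * ω) ^ 2 * x) + 8 * π ^ 2 * x) * Real.cos (2 * π * x * ω)
              + ((2 * π * ω) ^ 2 * (1 - x ^ 2) + (2 * π * x) ^ 2)
                  * (-(2 * π * ω) * Real.sin (2 * π * x * ω))
              - (4 * π * ω * Real.sin (2 * π * x * ω)
                  + 4 * π * ω * x * ((2 * π * ω) * Real.cos (2 * π * x * ω)))))
        + (2 * π * 1 * x) ^ 2 *
          (((2 * π * ω) ^ 2 * (1 - x ^ 2) + (2 * π * x) ^ 2) * Real.cos (2 * π * x * ω)
            - 4 * π * ω * x * Real.sin (2 * π * x * ω))| ≤ C := by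
  let k : ℝ × ℝ → ℝ := fun p ↦
      -(((1 : ℝ) ^ 2 - p.1 ^ 2) *
            ((-(2 * (2 * π * p.2) ^ 2) + 8 * π ^ 2) * Real.cos (2 * π * p.1 * p.2)
              + (-(2 * (2 * π * p.2) ^ 2 * p.1) + 8 * π ^ 2 * p.1)
                  * (-(2 * π * p.2) * Real.sin (2 * π * p.1 * p.2))
              + ((-(2 * (2 * π * p.2) ^ 2 * p.1) + 8 * π ^ 2 * p.1)
                    * (-(2 * π * p.2) * Real.sin (2 * π * p.1 * p.2))
                  + ((2 * π * p.2) ^ 2 * (1 - p.1 ^ 2) + (2 * π * p.1) ^ 2)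
                      * (-(2 * π * p.2) ^ 2 * Real.cos (2 * π * p.1 * p.2)))
              - (4 * π * p.2 * ((2 * π * p.2) * Real.cos (2 * π * p.1 * p.2))
                  + (4 * π * p.2 * ((2 * π * p.2) * Real.cos (2 * π * p.1 * p.2))
                      + 4 * π * p.2 * p.1 *
                        ((2 * π * p.2) * (-(2 * π * p.2) * Real.sin (2 * π * p.1 * p.2))))))
          - 2 * p.1 *
            ((-(2 * (2 * π * p.2) ^ 2 * p.1) + 8 * π ^ 2 * p.1) * Real.cos (2 * π * p.1 * p.2)
              + ((2 * π * p.2) ^ 2 * (1 - p.1 ^ 2) + (2 * π * p.1) ^ 2)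
                  * (-(2 * π * p.2) * Real.sin (2 * π * p.1 * p.2))
              - (4 * π * p.2 * Real.sin (2 * π * p.1 * p.2)
                  + 4 * π * p.2 * p.1 * ((2 * π * p.2) * Real.cos (2 * π * p.1 * p.2)))))
        + (2 * π * 1 * p.1) ^ 2 *
          (((2 * π * p.2) ^ 2 * (1 - p.1 ^ 2) + (2 * π * p.1) ^ 2) * Real.cos (2 * π * p.1 * p.2)
            - 4 * π * p.2 * p.1 * Real.sin (2 * π * p.1 * p.2))
  have hk : Continuous k := by
    unfold k
    fun_prop
  have hK : IsCompact (Icc (-1 : ℝ) 1 ×ˢ Icc (-1 : ℝ) 1) := isCompact_Icc.prod isCompact_Icc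
  obtain ⟨C, hC⟩ := hK.exists_bound_of_continuousOn hk.continuousOn
  refine ⟨C, fun ω hω x hx ↦ ?_⟩
  have h := hC (x, ω) ⟨hx, hω⟩
  simpa [k, Real.norm_eq_abs] using h

/-! ## The decay estimate -/

/-- RH-FREE. **`χ² λ(n) ψ_n(ω) = ∫ ψ_n · L²(cos wave)`, bounded uniformly**: there is `C` with
`χ² · |λ(n)| · |ψ_n(ω)| ≤ C` for every `n`, every eigenvalue `χ` of `ψ_n = prolateFun n` and every
`ω ∈ [−1,1]`. [cite: ConnesConsani2021, §4 p. 16 eqs. (prolateeq)–(cosalphan) (arXiv p0016:L17–L28); SlepianPollak1961, §III] -/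
theorem exists_bound_eigen_sq_mul_prolateEigen_mul :
    ∃ C : ℝ, ∀ n : ℕ, ∀ χ : ℝ,
      (∀ x ∈ Ioo (-1 : ℝ) 1,
        -(deriv (fun y ↦ ((1 : ℝ) ^ 2 - y ^ 2) * deriv (prolateFun n) y) x)
          + (2 * π * 1 * x) ^ 2 * prolateFun n x = χ * prolateFun n x) →
      ∀ ω ∈ Icc (-1 : ℝ) 1, χ ^ 2 * |prolateEigen n| * |prolateFun n ω| ≤ C := by
  obtain ⟨C, hC⟩ := exists_bound_prolateOp_hWave
  have hC0 : 0 ≤ C := le_trans (abs_nonneg _) (hC 0 (by norm_num) 0 (by norm_num))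
  refine ⟨3 / 2 * C, fun n χ hχ ω hω ↦ ?_⟩
  have hf := isProlateFunction_prolateFun n
  set φ := prolateFun n with hφ
  have hle : (-1 : ℝ) ≤ 1 := by norm_num
  have hfc : ContinuousOn φ (Icc (-1) 1) := hf.contDiffOn.continuousOn
  -- (cosalphan): `∫ φ cos(2πxω) = λ(n) φ(ω)`
  have hcos : ∫ x in (-1 : ℝ)..1, φ x * Real.cos (2 * π * x * ω) = prolateEigen n * φ ω := by
    rw [prolateEigen_eq_intervalIntegral]
    exact hf.integral_mul_cos_eq_mul hω
  -- Green symmetry, twice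
  have hG1 := hf.eigen_mul_integral_mul_eq hχ
    (fun x ↦ hasDerivAt_cosWave ω x) (fun x ↦ hasDerivAt_cosWave₁ ω x) (by fun_prop)
  have hG1' : χ * ∫ x in (-1 : ℝ)..1, φ x * Real.cos (2 * π * x * ω) =
      ∫ x in (-1 : ℝ)..1, φ x *
        (((2 * π * ω) ^ 2 * (1 - x ^ 2) + (2 * π * x) ^ 2) * Real.cos (2 * π * x * ω)
          - 4 * π * ω * x * Real.sin (2 * π * x * ω)) := by
    rw [hG1]
    refine intervalIntegral.integral_congr fun x _ ↦ ?_
    simp only [prolateOp_cosWave]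
  -- the integrand of the second Green identity is `φ · k_ω` with `|k_ω| ≤ C`
  set kω : ℝ → ℝ := fun x ↦
      -(((1 : ℝ) ^ 2 - x ^ 2) *
            ((-(2 * (2 * π * ω) ^ 2) + 8 * π ^ 2) * Real.cos (2 * π * x * ω)
              + (-(2 * (2 * π * ω) ^ 2 * x) + 8 * π ^ 2 * x) * (-(2 * π * ω) * Real.sin (2 * π * x * ω))
              + ((-(2 * (2 * π * ω) ^ 2 * x) + 8 * π ^ 2 * x) * (-(2 * π * ω) * Real.sin (2 * π * x * ω))
                  + ((2 * π * ω) ^ 2 * (1 - x ^ 2) + (2 * π * x) ^ 2)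
                      * (-(2 * π * ω) ^ 2 * Real.cos (2 * π * x * ω)))
              - (4 * π * ω * ((2 * π * ω) * Real.cos (2 * π * x * ω))
                  + (4 * π * ω * ((2 * π * ω) * Real.cos (2 * π * x * ω))
                      + 4 * π * ω * x * ((2 * π * ω) * (-(2 * π * ω) * Real.sin (2 * π * x * ω))))))
          - 2 * x *
            ((-(2 * (2 * π * ω) ^ 2 * x) + 8 * π ^ 2 * x) * Real.cos (2 * π * x * ω)
              + ((2 * π * ω) ^ 2 * (1 - x ^ 2) + (2 * π * x) ^ 2)
                  * (-(2 * π * ω) * Real.sin (2 * π * x * ω))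
              - (4 * π * ω * Real.sin (2 * π * x * ω)
                  + 4 * π * ω * x * ((2 * π * ω) * Real.cos (2 * π * x * ω)))))
        + (2 * π * 1 * x) ^ 2 *
          (((2 * π * ω) ^ 2 * (1 - x ^ 2) + (2 * π * x) ^ 2) * Real.cos (2 * π * x * ω)
            - 4 * π * ω * x * Real.sin (2 * π * x * ω)) with hkω
  have hkc : Continuous kω := by rw [hkω]; fun_prop
  have hG2' : χ * ∫ x in (-1 : ℝ)..1, φ x *
        (((2 * π * ω) ^ 2 * (1 - x ^ 2) + (2 * π * x) ^ 2) * Real.cos (2 * π * x * ω)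
          - 4 * π * ω * x * Real.sin (2 * π * x * ω)) = ∫ x in (-1 : ℝ)..1, φ x * kω x := by
    rw [hkω]
    exact hf.eigen_mul_integral_mul_eq hχ
      (fun x ↦ hasDerivAt_hWave ω x) (fun x ↦ hasDerivAt_hWave₁ ω x) (by fun_prop)
  -- so `χ² λ φ(ω) = ∫ φ kω`
  have hkey : χ ^ 2 * (prolateEigen n * φ ω) = ∫ x in (-1 : ℝ)..1, φ x * kω x := by
    rw [← hcos, pow_two, mul_assoc, hG1', hG2']
  -- bound the right-hand side: `|∫ φ kω| ≤ C ∫ |φ| ≤ C · 3/2`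
  have hφi : IntervalIntegrable (fun x ↦ |φ x|) volume (-1) 1 :=
    hfc.abs.intervalIntegrable_of_Icc hle
  have hφ2i : IntervalIntegrable (fun x ↦ φ x ^ 2) volume (-1) 1 :=
    (hfc.pow 2).intervalIntegrable_of_Icc hle
  have hφki : IntervalIntegrable (fun x ↦ φ x * kω x) volume (-1) 1 :=
    (hfc.mul hkc.continuousOn).intervalIntegrable_of_Icc hle
  have hb1 : |∫ x in (-1 : ℝ)..1, φ x * kω x| ≤ ∫ x in (-1 : ℝ)..1, C * |φ x| := by
    refine (intervalIntegral.abs_integral_le_integral_abs hle).trans ?_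
    refine intervalIntegral.integral_mono_on hle (hφki.abs) (hφi.const_mul C) fun x hx ↦ ?_
    rw [abs_mul, mul_comm]
    exact mul_le_mul_of_nonneg_right (hC ω hω x hx) (abs_nonneg _)
  have hb2 : ∫ x in (-1 : ℝ)..1, C * |φ x| ≤ C * (3 / 2) := by
    rw [intervalIntegral.integral_const_mul]
    refine mul_le_mul_of_nonneg_left ?_ hC0
    have hptw : ∀ x ∈ Icc (-1 : ℝ) 1, |φ x| ≤ (1 + φ x ^ 2) / 2 := by
      intro x _
      have h0 : 0 ≤ (|φ x| - 1) ^ 2 := sq_nonneg _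
      have h1 : |φ x| ^ 2 = φ x ^ 2 := sq_abs _
      nlinarith
    have hmono := intervalIntegral.integral_mono_on hle hφi
      ((intervalIntegrable_const.add hφ2i).div_const 2) hptw
    have hval : ∫ x in (-1 : ℝ)..1, (1 + φ x ^ 2) / 2 = 3 / 2 := by
      rw [intervalIntegral.integral_div, intervalIntegral.integral_add intervalIntegrable_const hφ2i,
        intervalIntegral.integral_const, hf.norm_one]
      norm_num
    linarith
  have hfin : |χ ^ 2 * (prolateEigen n * φ ω)| ≤ 3 / 2 * C := by
    rw [hkey]; linarith
  calc χ ^ 2 * |prolateEigen n| * |prolateFun n ω|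
      = |χ ^ 2 * (prolateEigen n * φ ω)| := by
        rw [abs_mul, abs_mul, abs_of_nonneg (sq_nonneg χ), mul_assoc]
    _ ≤ 3 / 2 * C := hfin

/-- RH-FREE. Some point of `[−1,1]` carries `|ψ_n| ≥ 1/2` (because `∫_{−1}^{1} ψ_n² = 1`).
[cite: ConnesConsaniMoscovici2025, §7 eq. (7.12) (normalisation)] -/
theorem exists_half_le_abs_prolateFun (n : ℕ) : ∃ ω ∈ Icc (-1 : ℝ) 1, 1 / 2 ≤ |prolateFun n ω| := by
  by_contra h
  push Not at h
  have hf := isProlateFunction_prolateFun n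
  have hle : (-1 : ℝ) ≤ 1 := by norm_num
  have hfc : ContinuousOn (prolateFun n) (Icc (-1) 1) := hf.contDiffOn.continuousOn
  have hφ2i : IntervalIntegrable (fun x ↦ prolateFun n x ^ 2) volume (-1) 1 :=
    (hfc.pow 2).intervalIntegrable_of_Icc hle
  have hmono : ∫ x in (-1 : ℝ)..1, prolateFun n x ^ 2 ≤ ∫ x in (-1 : ℝ)..1, (1 / 4 : ℝ) := by
    refine intervalIntegral.integral_mono_on hle hφ2i intervalIntegrable_const fun x hx ↦ ?_
    have h1 := h x hx
    have h2 : prolateFun n x ^ 2 = |prolateFun n x| ^ 2 := (sq_abs _).symm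
    rw [h2]
    nlinarith [abs_nonneg (prolateFun n x)]
  rw [intervalIntegral.integral_const, hf.norm_one] at hmono
  norm_num at hmono

/-- RH-FREE. **Polynomial decay of `λ(n)` in the Sturm index**: there is `C` with
`|λ(n)| · (2n(2n+1))² ≤ C` for all `n` (`χ_{2n} > 2n(2n+1)`, [Wang 2010, Lemma 2.2]).
[cite: ConnesConsani2021, §4 p. 16 (arXiv p0016:L17–L36); WangLL2010, Lemma 2.2] -/
theorem exists_bound_abs_prolateEigen_mul_sq_sq :
    ∃ C : ℝ, ∀ n : ℕ, |prolateEigen n| * ((2 * (n : ℝ)) * (2 * n + 1)) ^ 2 ≤ C := by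
  obtain ⟨C, hC⟩ := exists_bound_eigen_sq_mul_prolateEigen_mul
  refine ⟨2 * C, fun n ↦ ?_⟩
  have hf := isProlateFunction_prolateFun n
  obtain ⟨χ, hχ⟩ := hf.eigen
  obtain ⟨ω, hω, hφω⟩ := exists_half_le_abs_prolateFun n
  have hb := hC n χ hχ ω hω
  have hlt : ((2 * n : ℕ) : ℝ) * ((2 * n : ℕ) + 1) < χ := hf.lt_eigen hχ
  have hN : (2 * (n : ℝ)) * (2 * n + 1) < χ := by push_cast at hlt; linarith
  have hN0 : 0 ≤ (2 * (n : ℝ)) * (2 * n + 1) := by positivity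
  have hχ0 : 0 ≤ χ := le_trans hN0 hN.le
  have hsq : ((2 * (n : ℝ)) * (2 * n + 1)) ^ 2 ≤ χ ^ 2 := pow_le_pow_left₀ hN0 hN.le 2
  have hl0 : 0 ≤ |prolateEigen n| := abs_nonneg _
  calc |prolateEigen n| * ((2 * (n : ℝ)) * (2 * n + 1)) ^ 2
      ≤ |prolateEigen n| * χ ^ 2 := mul_le_mul_of_nonneg_left hsq hl0
    _ = 2 * (χ ^ 2 * |prolateEigen n| * (1 / 2)) := by ring
    _ ≤ 2 * (χ ^ 2 * |prolateEigen n| * |prolateFun n ω|) := by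
        gcongr
    _ ≤ 2 * C := by linarith

/-- RH-FREE. **The decay input of the archimedean density chain, UNCONDITIONALLY:
`Σ_n |λ(n)|·n² < ∞`** (indeed `|λ(n)| n² ≤ C/(16n²)`).  This is the single hypothesis `hdec` of
`exists_contDiff_isArchDensity_of_summable` / `CC2021_lemma_5_4_of_summable` (seat gm-t16,
`ArchDensityOfMajorant.lean`); it needs neither [Rokhlin–Xiao 2007, Thm 14] (conjecture-class in print,
cell erratum E17) nor [Osipov 2013, Thm 33].
[cite: ConnesConsani2021, §4 p. 16 eq. (rapid-decay) (arXiv p0016:L36) — replaced here by polynomial decay; App. F Lemma F.1 (arXiv Lemma 49), arXiv PDF pp. 54–55 (where only summability against `n²` is consumed)] -/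
theorem summable_abs_prolateEigen_mul_sq : Summable (fun n : ℕ ↦ |prolateEigen n| * (n : ℝ) ^ 2) := by
  obtain ⟨C, hC⟩ := exists_bound_abs_prolateEigen_mul_sq_sq
  have hC0 : 0 ≤ C := le_trans (by positivity) (hC 0)
  -- comparison with `C/16 · 1/n²`
  have hs : Summable (fun n : ℕ ↦ C / 16 * (1 / (n : ℝ) ^ 2)) :=
    (Real.summable_one_div_nat_pow.mpr one_lt_two).mul_left _
  refine Summable.of_nonneg_of_le (fun n ↦ by positivity) (fun n ↦ ?_) hs
  rcases Nat.eq_zero_or_pos n with rfl | hn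
  · simp
  · have hn1 : (1 : ℝ) ≤ n := by exact_mod_cast hn
    have hpos : (0 : ℝ) < (n : ℝ) ^ 2 := by positivity
    rw [mul_one_div, le_div_iff₀ hpos]
    have h := hC n
    have hl0 : 0 ≤ |prolateEigen n| := abs_nonneg _
    -- `16 n⁴ ≤ (2n(2n+1))²`
    have h16 : 16 * ((n : ℝ) ^ 2 * (n : ℝ) ^ 2) ≤ ((2 * (n : ℝ)) * (2 * n + 1)) ^ 2 := by
      nlinarith [hn1]
    calc |prolateEigen n| * (n : ℝ) ^ 2 * (n : ℝ) ^ 2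
        = (|prolateEigen n| * (16 * ((n : ℝ) ^ 2 * (n : ℝ) ^ 2))) / 16 := by ring
      _ ≤ (|prolateEigen n| * ((2 * (n : ℝ)) * (2 * n + 1)) ^ 2) / 16 := by gcongr
      _ ≤ C / 16 := by gcongr

/-! ## Corollaries: the three §5 named facts, discharged, and the K0 input hypothesis-free -/

/-- RH-FREE. **Connes–Consani 2021, Lemma 5.4 — DISCHARGED** (`CC2021_lemma_5_4_holds`): the slope
series `Σ t(n)` is summable and `ε′(1⁺) = Σ' t(n)`, for THE even prolate family; by gm-t16's
`CC2021_lemma_5_4_of_summable` and `summable_abs_prolateEigen_mul_sq`.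
[cite: ConnesConsani2021, Lemma 5.4 §5 pp. 32–33 (arXiv item Lemma 31, chunk p0020:L86–L101)] -/
theorem CC2021_lemma_5_4_holds : CC2021_lemma_5_4 :=
  CC2021_lemma_5_4_of_summable summable_abs_prolateEigen_mul_sq

/-- RH-FREE. **Connes–Consani 2021, Prop. 5.3 — DISCHARGED** (`CC2021_prop_5_3_holds`).
[cite: ConnesConsani2021, Prop. 5.3 eqs. (97)–(98) §5 p. 32 (arXiv item Prop. 30, chunk p0020:L59–L67)] -/
theorem CC2021_prop_5_3_holds : CC2021_prop_5_3 :=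
  CC2021_prop_5_3_of_summable summable_abs_prolateEigen_mul_sq

/-- RH-FREE. **Connes–Consani 2021, Rem. 5.6 — DISCHARGED** (`CC2021_rem_5_6_holds`).
[cite: ConnesConsani2021, Rem. 5.6 §5 p. 34 (arXiv item Rem. 33, chunk p0021:L10)] -/
theorem CC2021_rem_5_6_holds : CC2021_rem_5_6 :=
  CC2021_rem_5_6_of_summable summable_abs_prolateEigen_mul_sq

/-- RH-FREE. **The K0 input, hypothesis-free**: a `C²` function on `ℝ` agreeing with `ε ∘ exp` on
`[0, ∞)` (an archimedean density), with slope `Σ' t(n)` and vanishing second derivative at `0` —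
gm-t16's `exists_contDiff_isArchDensity_of_summable` fed with `summable_abs_prolateEigen_mul_sq`.
[cite: ConnesConsani2021, Prop. 5.3 §5 p. 32 (arXiv item Prop. 30); Lemma 5.4 pp. 32–33; App. F Lemma F.1 (arXiv Lemma 49), arXiv PDF pp. 54–55] -/
theorem exists_contDiff_isArchDensity_summable_free :
    ∃ G : ℝ → ℂ, ContDiff ℝ 2 G ∧ IsArchDensity G ∧ EqOn G (epsDensity prolateFun) (Ici 0) ∧
      deriv G 0 = ((∑' n, epsSlopeTerm (prolateFun n) : ℝ) : ℂ) ∧ deriv (deriv G) 0 = 0 :=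
  exists_contDiff_isArchDensity_of_summable summable_abs_prolateEigen_mul_sq

end Literature.NumberTheory.ConnesConsani2021

end
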